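import Literature.MathematicalPhysics.QuantumFieldTheory.Balaban1983to89.B11Prop6Scheme
import Summits.QuantumFields.BalabanUV.T4Continuum.Support.ShellMeasureLevelAssembly

/-!
# `T4Continuum.ShellMeasureMinimiserBonds` — SM-L1 SHARPENED: the (AN-bound)_j binder of END-II from B11 Prop. 6's
# CONTRACTION SCHEME (kernel in the tree) + bond read-outs + a flat centre + the holonomy dictionary
# (cell `pub-balaban`, sub-cell `t4`, spine estimate NE7c (node U5b); lineage t4-ne7c-p1 = PROVER seat P1
# «shell-measure route», generation 26; row S14 of the crew claim table `t4/b2b-balaban-t4-ne7c-p1/LEAVES-NE7c-P1.md`;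
# ADDITIVE — imports the tree's `B11Prop6Scheme` (b11 lineage; hence `B13Contraction113`, `B8SectDSource`, `B11`) and
# `ShellMeasureLevelAssembly` (p206468) only; 0 `def`, 0 sorry; v1.1 = v1 p208432 + §5, the LANDAU EXPONENT Ψ = id − H∘D threaded
# through the read-outs — crew locator FINDING F-ne7cleaf02-1, append-only)

HONEST FRAMING.  Finite four-torus programme, rung (B)+1 only — NOT infinite volume, NOT a mass gap, NOT the Clay
problem, NOT summit progress; (B), `BetaPertHyp`, (B^μ) not consumed.  (M1) for BAŁABAN'S INDUCTIVELY DEFINED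
EFFECTIVE MEASURES is NOT PRINTED (GAPS G-ne7cp1-1), asserted by nobody, NOT moved here.  This file RE-SOURCES one
binder of END-II (`ShellMeasureRootCompositionSU2.slotAC_realized_su2_of_levelData`, p207698): SM-L1 = (AN-bound)_j
«the localized minimiser's bond variables along the complexified block contraction extend holomorphically to the disc
`‖w‖ < Rad` with a uniform bound» — located, B11 Prop. 9 TYPE, whose residuals the crew's locator verdict
(C-ne7cleaf02-1) named as (i) the margin of the small-field window inside the analyticity domain and (ii) the bond bound
ON THE COMPLEX DOMAIN, neither displayed as numbers in [Balaban1985Variational].  B11's complex analyticity IS its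
Sect. E contraction scheme (116)–(121) repeated for the complex pair (p. 305–306), and that scheme is KERNEL in the tree
over abstract complex Banach spaces: `B11Prop6Scheme.solution_analytic` (successive approximations holomorphic in the
parameter, `B13Contraction113.differentiableOn_fixedPoint`).  Here it is WIRED to END-II's `hAN`:
* §1 `solutionFamily_of_prop6Scheme`: on the disc `‖σ‖ < Rad`, for HOLOMORPHIC DATA FAMILIES `σ ↦ J_σ` (current) and
  `σ ↦ 𝔄_σ` (background part, `𝔄_σ = H₁B_σ` for the coarse field `B_σ = σ·x` of the contraction ray — DICTIONARY) with
  `‖J_σ‖ ≤ j`, `‖𝔄_σ‖ < a` and a FLAT CENTRE `J_0 = 0`, `𝔄_0 = 0`, under the scheme's hypotheses — (P2) `‖𝒢f‖ ≤ B₀‖f‖`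
  ([Balaban1985PropagatorsII] Thm 3.13 TYPE), (P4) `Prop4Hyp W C₄ a₃` ([Balaban1985Variational] Prop. 4 (97)–(98) TYPE:
  quadratic bound + analyticity of `(δ/δA′)V`), the numeric conditions (118)/(121) — there is a holomorphic solution
  family `X_σ` of `X = −𝒢J_σ + Λ(X + 𝔄_σ) − 𝒢W(X + 𝔄_σ)` with `‖X_σ‖ ≤ ε₄`, unique in that ball, and `X_0 = 0`.
* §2 `bondFn_of_solution`: a BOND READ-OUT `ℓ (X_σ + 𝔄_σ)` of the full configuration (`ℓ` a continuous `ℂ`-linear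
  map into a complete normed algebra `A` with `‖ℓ Y‖ ≤ κ‖Y‖` — evaluation at a bond against the (115)-norm,
  DICTIONARY) is holomorphic on the disc, bounded by `κ(ε₄ + a)`, and vanishes at `0`.
* §3 `classifierWitness_of_solution`: for a plaquette read as a list of `m` read-outs and the HOLONOMY DICTIONARY
  «`hol c` = the word of exponentials of the read-outs at the real parameter `c ∈ [0,1]`», END-II's `hAN` witness:
  `∃ f`, holomorphic on `ball 0 Rad`, `‖f‖ ≤ e^{m·κ(ε₄+a)} − 1`, `f 0 = 0`, `f c = hol c − 1`
  (`ShellMeasureLevelAssembly.classifierWitness_of_bondData`).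
CONSEQUENCE for the wall's book-keeping (GAPS G-ne7cp1-14 and G-ne7cp1-27): residual (ii) is now a KERNEL consequence (`a_b =
κ(ε₄ + a)`, no «same analyticity properties» reading); residual (i) is the DISPLAYED number condition `1 < Rad` where
`Rad` is the radius of a disc on which the ray family stays in the scheme's domain (`‖𝔄_σ‖ < a`; e.g. `Rad = a/‖𝔄₁‖`
for linear `𝔄_σ = σ•𝔄₁`, `rayFamily_linear`) — a comparison of the small-field window (θ_j-sized coarse fields) with
Prop. 6's domain (ε₁-sized).  WHAT REMAINS LOCATED: (P2), (P4), the ray-family bounds ((75)/(103) TYPE), k-uniformity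
of `B₀ C₄ a₃` («depend on d and L only» — displayed as sentences), the two dictionaries.  0 sorry, 0 citations of the
audited series as authority (its displays enter as the TYPED HYPOTHESES of `B11Prop6Scheme`, by name).  HONEST
DEPENDENCY (cell): continuum YM on T⁴ ⇐ BetaPertH ∧ nine spine estimates (0/9 proved); BetaPertH ⇐ (D1) ∧ (D4) ∧
CAP+tail; G-an2-4 gates asym, D1 and NE2/3/4.

v1.1 (crew locator FINDING F-ne7cleaf02-1, `XREAD-SM-L1-S14Binders.md`, GAPS C-ne7cleaf02-7).  Print's bond variables
are NOT linear read-outs of `Y = 𝒜₁ + H₁B`: the Landau exponent is `Ψ(Y) = Y − HD(Y)` ([Balaban1985Variational] (112),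
(174), (47)), `D` nonlinear analytic of second order ((55), (177)).  §5 threads an abstract holomorphic `Ψ` (one more
binder of DISPLAYED TYPE: (Ψ-an) «`Ψ` holomorphic on the ball `‖Y‖ < r₀`, `Ψ 0 = 0`, `‖Ψ Y‖ ≤ ψ̄` there» — p. 286
(55)/(57) + Prop. 3 TYPE) through the read-outs: `bondFn_of_solution_landau`, `classifierWitness_of_solution_landau`,
`classifierWitness_of_prop6Scheme_landau` (holonomy dictionary for `Ψ(X_σ + 𝔄_σ)`, `H = e^{m·κ·ψ̄} − 1`).  The same
locator lets the instantiator take `Jf := 0` ((171)/(175): no `𝔊J` term at a minimiser background) and `κ = 1`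
((115)/(77): evaluation at a bond); §1–§4 stand (they are the case `Ψ = id`).
-/

noncomputable section

open Set Metric NormedSpace

namespace Summit.QuantumFields.BalabanUV.T4Continuum.ShellMeasureMinimiserBonds

open Literature.MathematicalPhysics.QuantumFieldTheory.Balaban1983to89
open B11Prop6Scheme (mapT Prop4Hyp solution_analytic)
open ShellMeasureWilsonWords (wordExp)
open ShellMeasureLevelAssembly (classifierWitness_of_bondData)

variable {𝒴 𝒵 : Type*} [NormedAddCommGroup 𝒴] [NormedSpace ℂ 𝒴] [CompleteSpace 𝒴]
  [NormedAddCommGroup 𝒵] [NormedSpace ℂ 𝒵]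
  {𝒢 : 𝒵 →L[ℂ] 𝒴} {Λ : 𝒴 →L[ℂ] 𝒴} {W : 𝒴 → 𝒵} {B₀ θ C₄ a₃ : ℝ}

/-! ## §1 The holomorphic solution family along a ray through a flat centre -/

omit [CompleteSpace 𝒴] in
/-- the scheme's map fixes `0` at flat data: `J = 0`, `𝔄 = 0` ⟹ `mapT 𝒢 Λ W 0 0 0 = 0` (`W 0 = 0` from the quadratic
bound of `Prop4Hyp`, `0 < a₃`). [folklore] -/
theorem mapT_zero_of_flat (hW : Prop4Hyp W C₄ a₃) (ha₃ : 0 < a₃) : mapT 𝒢 Λ W (0 : 𝒵) (0 : 𝒴) 0 = 0 := by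
  have hW0 : W 0 = 0 := by
    have h := hW.quad 0 (by simpa using ha₃)
    simp only [norm_zero, ne_eq, OfNat.ofNat_ne_zero, not_false_eq_true, zero_pow, mul_zero,
      norm_le_zero_iff] at h
    exact h
  simp [B11Prop6Scheme.mapT_apply, hW0]

/-- **THE HOLOMORPHIC SOLUTION FAMILY ALONG A RAY THROUGH A FLAT CENTRE.**  Under the hypotheses of
`B11Prop6Scheme.solution_analytic` on the disc `‖σ‖ < Rad` (holomorphic data `J_σ`, `𝔄_σ` with `‖J_σ‖ ≤ j`,
`‖𝔄_σ‖ < a`; (P2), (P4), (118)/(121)) and a FLAT CENTRE `J_0 = 0`, `𝔄_0 = 0`: a holomorphic `X : ℂ → 𝒴` on the disc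
with `‖X σ‖ ≤ ε₄`, `X σ` the unique solution in that ball, and `X 0 = 0` (flat data ⟹ the zero configuration solves,
uniqueness). [folklore] -/
theorem solutionFamily_of_prop6Scheme (h𝒢 : ∀ f, ‖𝒢 f‖ ≤ B₀ * ‖f‖) (hΛ : ∀ Y, ‖Λ Y‖ ≤ θ * ‖Y‖)
    (hW : Prop4Hyp W C₄ a₃) (hB₀ : 0 ≤ B₀) (hC₄ : 0 ≤ C₄) (hθ : 0 ≤ θ) {j a ε₄ : ℝ} (hε₄ : 0 ≤ ε₄)
    (hdom : 2 * (ε₄ + a) ≤ a₃) (hself : B₀ * j + θ * (ε₄ + a) + B₀ * C₄ * (ε₄ + a) ^ 2 ≤ ε₄)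
    (hcontr : θ + 4 * B₀ * C₄ * (ε₄ + a) < 1) {Rad : ℝ} (hRad : 0 < Rad) {Jf : ℂ → 𝒵} {𝔄f : ℂ → 𝒴}
    (hJd : DifferentiableOn ℂ Jf (ball 0 Rad)) (h𝔄d : DifferentiableOn ℂ 𝔄f (ball 0 Rad))
    (hJ : ∀ σ ∈ ball (0 : ℂ) Rad, ‖Jf σ‖ ≤ j) (h𝔄 : ∀ σ ∈ ball (0 : ℂ) Rad, ‖𝔄f σ‖ < a)
    (hJ0 : Jf 0 = 0) (h𝔄0 : 𝔄f 0 = 0) :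
    ∃ X : ℂ → 𝒴, DifferentiableOn ℂ X (ball 0 Rad) ∧
      (∀ σ ∈ ball (0 : ℂ) Rad, ‖X σ‖ ≤ ε₄ ∧ mapT 𝒢 Λ W (Jf σ) (𝔄f σ) (X σ) = X σ ∧
        ∀ X' : 𝒴, ‖X'‖ ≤ ε₄ → mapT 𝒢 Λ W (Jf σ) (𝔄f σ) X' = X' → X' = X σ) ∧ X 0 = 0 := by
  obtain ⟨X, hXd, hX⟩ := solution_analytic h𝒢 hΛ hW hB₀ hC₄ hθ hε₄ hdom hself hcontr isOpen_ball hJd h𝔄d hJ h𝔄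
  have h0 : (0 : ℂ) ∈ ball (0 : ℂ) Rad := mem_ball_self hRad
  have ha : 0 < a := (norm_nonneg _).trans_lt (h𝔄 0 h0)
  have ha₃ : 0 < a₃ := by linarith
  refine ⟨X, hXd, hX, ?_⟩
  have huniq := (hX 0 h0).2.2 0 (by simpa using hε₄)
  rw [hJ0, h𝔄0] at huniq
  exact (huniq (mapT_zero_of_flat hW ha₃)).symm

omit [CompleteSpace 𝒴] in
/-- THE LINEAR RAY FAMILY is admissible: `𝔄_σ = σ • 𝔄₁` is entire, vanishes at `0`, and satisfies `‖𝔄_σ‖ < a` on the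
disc `‖σ‖ < a/‖𝔄₁‖` — so the disc radius `Rad` of §1 is the DISPLAYED number `a/‖𝔄₁‖` (residual (i) of the locator
verdict as an inequality between two located sizes). [folklore] -/
theorem rayFamily_linear (𝔄₁ : 𝒴) {a : ℝ} (h𝔄₁ : 𝔄₁ ≠ 0) :
    DifferentiableOn ℂ (fun σ : ℂ => σ • 𝔄₁) (ball 0 (a / ‖𝔄₁‖)) ∧ (fun σ : ℂ => σ • 𝔄₁) 0 = 0 ∧
      ∀ σ ∈ ball (0 : ℂ) (a / ‖𝔄₁‖), ‖σ • 𝔄₁‖ < a := by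
  have hn : 0 < ‖𝔄₁‖ := norm_pos_iff.2 h𝔄₁
  refine ⟨(differentiable_id.smul_const 𝔄₁).differentiableOn, by simp, fun σ hσ => ?_⟩
  rw [mem_ball_zero_iff] at hσ
  rw [norm_smul]
  calc ‖σ‖ * ‖𝔄₁‖ < a / ‖𝔄₁‖ * ‖𝔄₁‖ := mul_lt_mul_of_pos_right hσ hn
    _ = a := div_mul_cancel₀ a hn.ne'

/-! ## §2 Bond read-outs of the solution family -/

section ReadOut

variable {A : Type*} [NormedRing A] [NormedAlgebra ℂ A] [CompleteSpace A]

omit [CompleteSpace 𝒴] [CompleteSpace A] in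
/-- **A BOND READ-OUT OF THE SOLUTION FAMILY** `σ ↦ ℓ (X σ + 𝔄f σ)` (`ℓ : 𝒴 →L[ℂ] A`, `‖ℓ Y‖ ≤ κ‖Y‖`): holomorphic on
the disc, bounded by `κ(ε₄ + a)` there, and `= 0` at `σ = 0` when `X 0 = 0`, `𝔄f 0 = 0` — the bond datum
`(Rad, a_b = κ(ε₄ + a))` of `ShellMeasureLevelAssembly.classifierWitness_of_bondData`. [folklore] -/
theorem bondFn_of_solution {Rad ε₄ a κ : ℝ} {X 𝔄f : ℂ → 𝒴} (hXd : DifferentiableOn ℂ X (ball 0 Rad))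
    (h𝔄d : DifferentiableOn ℂ 𝔄f (ball 0 Rad)) (hX : ∀ σ ∈ ball (0 : ℂ) Rad, ‖X σ‖ ≤ ε₄)
    (h𝔄 : ∀ σ ∈ ball (0 : ℂ) Rad, ‖𝔄f σ‖ < a) (hX0 : X 0 = 0) (h𝔄0 : 𝔄f 0 = 0)
    (ℓ : 𝒴 →L[ℂ] A) (hκ : 0 ≤ κ) (hℓ : ∀ Y, ‖ℓ Y‖ ≤ κ * ‖Y‖) :
    DifferentiableOn ℂ (fun σ => ℓ (X σ + 𝔄f σ)) (ball 0 Rad) ∧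
      (∀ w ∈ ball (0 : ℂ) Rad, ‖ℓ (X w + 𝔄f w)‖ ≤ κ * (ε₄ + a)) ∧ ℓ (X 0 + 𝔄f 0) = 0 := by
  refine ⟨ℓ.differentiable.comp_differentiableOn (hXd.add h𝔄d), fun w hw => ?_, by rw [hX0, h𝔄0, add_zero, map_zero]⟩
  calc ‖ℓ (X w + 𝔄f w)‖ ≤ κ * ‖X w + 𝔄f w‖ := hℓ _
    _ ≤ κ * (ε₄ + a) := by
        refine mul_le_mul_of_nonneg_left ?_ hκ
        exact (norm_add_le _ _).trans (add_le_add (hX w hw) (h𝔄 w hw).le)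

omit [CompleteSpace 𝒴] [CompleteSpace A] in
/-- bookkeeping: the read-out family of a list of bond functionals. [folklore] -/
theorem bondFns_of_solution {Rad ε₄ a κ : ℝ} {X 𝔄f : ℂ → 𝒴} (hXd : DifferentiableOn ℂ X (ball 0 Rad))
    (h𝔄d : DifferentiableOn ℂ 𝔄f (ball 0 Rad)) (hX : ∀ σ ∈ ball (0 : ℂ) Rad, ‖X σ‖ ≤ ε₄)
    (h𝔄 : ∀ σ ∈ ball (0 : ℂ) Rad, ‖𝔄f σ‖ < a) (hX0 : X 0 = 0) (h𝔄0 : 𝔄f 0 = 0)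
    (ℓs : List (𝒴 →L[ℂ] A)) (hκ : 0 ≤ κ) (hℓ : ∀ ℓ ∈ ℓs, ∀ Y, ‖ℓ Y‖ ≤ κ * ‖Y‖) :
    (∀ Xb ∈ ℓs.map (fun ℓ => fun σ => ℓ (X σ + 𝔄f σ)), DifferentiableOn ℂ Xb (ball 0 Rad)) ∧
      (∀ Xb ∈ ℓs.map (fun ℓ => fun σ => ℓ (X σ + 𝔄f σ)), ∀ w ∈ ball (0 : ℂ) Rad, ‖Xb w‖ ≤ κ * (ε₄ + a)) ∧
      (∀ Xb ∈ ℓs.map (fun ℓ => fun σ => ℓ (X σ + 𝔄f σ)), Xb 0 = 0) := by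
  refine ⟨fun Xb hXb => ?_, fun Xb hXb => ?_, fun Xb hXb => ?_⟩ <;>
    obtain ⟨ℓ, hℓm, rfl⟩ := List.mem_map.1 hXb
  · exact (bondFn_of_solution hXd h𝔄d hX h𝔄 hX0 h𝔄0 ℓ hκ (hℓ ℓ hℓm)).1
  · exact (bondFn_of_solution hXd h𝔄d hX h𝔄 hX0 h𝔄0 ℓ hκ (hℓ ℓ hℓm)).2.1
  · exact (bondFn_of_solution hXd h𝔄d hX h𝔄 hX0 h𝔄0 ℓ hκ (hℓ ℓ hℓm)).2.2

/-! ## §3 END-II's `hAN` witness for a plaquette of read-outs -/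

omit [CompleteSpace 𝒴] in
/-- **THE (AN-bound) WITNESS OF A PLAQUETTE FROM THE SOLUTION FAMILY.**  Data: a holomorphic solution family `X`
and background family `𝔄f` on `ball 0 Rad` with `‖X‖ ≤ ε₄`, `‖𝔄f‖ < a`, flat centre (§1); the plaquette's oriented
bond READ-OUTS `ℓ₁, …, ℓ_m : 𝒴 →L[ℂ] A` with `‖ℓ_i Y‖ ≤ κ‖Y‖`; the HOLONOMY DICTIONARY: at a real parameter
`c ∈ [0,1]` the plaquette holonomy `hol c` is the word of exponentials of the read-outs (the gauge `U = exp(iη𝓗)` of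
[Balaban1985Variational] (176)).  CONCLUSION: the `hAN` witness of `slotAC_realized_su2_of_levelData` for this plaquette
— `f` holomorphic on `ball 0 Rad`, `‖f‖ ≤ e^{m·κ(ε₄+a)} − 1`, `f 0 = 0`, `f c = hol c − 1` on `[0,1]`. [folklore] -/
theorem classifierWitness_of_solution {Rad ε₄ a κ : ℝ} {X 𝔄f : ℂ → 𝒴} (hXd : DifferentiableOn ℂ X (ball 0 Rad))
    (h𝔄d : DifferentiableOn ℂ 𝔄f (ball 0 Rad)) (hX : ∀ σ ∈ ball (0 : ℂ) Rad, ‖X σ‖ ≤ ε₄)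
    (h𝔄 : ∀ σ ∈ ball (0 : ℂ) Rad, ‖𝔄f σ‖ < a) (hX0 : X 0 = 0) (h𝔄0 : 𝔄f 0 = 0)
    (ℓs : List (𝒴 →L[ℂ] A)) (hκ : 0 ≤ κ) (hℓ : ∀ ℓ ∈ ℓs, ∀ Y, ‖ℓ Y‖ ≤ κ * ‖Y‖)
    {hol : ℝ → A} (hhol : ∀ c : ℝ, 0 ≤ c → c ≤ 1 →
      hol c = wordExp (ℓs.map fun ℓ => ℓ (X (c : ℂ) + 𝔄f (c : ℂ)))) :
    ∃ f : ℂ → A, DifferentiableOn ℂ f (ball 0 Rad) ∧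
      (∀ w ∈ ball (0 : ℂ) Rad, ‖f w‖ ≤ Real.exp (ℓs.length * (κ * (ε₄ + a))) - 1) ∧ f 0 = 0 ∧
      ∀ c : ℝ, 0 ≤ c → c ≤ 1 → f (c : ℂ) = hol c - 1 := by
  obtain ⟨hd, hb, h0⟩ := bondFns_of_solution hXd h𝔄d hX h𝔄 hX0 h𝔄0 ℓs hκ hℓ
  have h := classifierWitness_of_bondData (Xs := ℓs.map (fun ℓ => fun σ => ℓ (X σ + 𝔄f σ))) hd hb h0
    (hol := hol) (fun c hc0 hc1 => by rw [hhol c hc0 hc1, List.map_map]; rfl)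
  rwa [List.length_map] at h

end ReadOut

/-! ## §4 The composite: from the scheme's hypotheses to the `hAN` witness in one call -/

section Composite

variable {A : Type*} [NormedRing A] [NormedAlgebra ℂ A] [CompleteSpace A]

/-- **SM-L1 FROM B11 PROP. 6's SCHEME, ONE CALL.**  (P2) + (P4) + (118)/(121) + holomorphic ray data with bounds and
a flat centre + bond read-outs + the holonomy dictionary (for the word of read-outs of THE solution family) ⟹ the
`hAN` witness with `(Rad, H = e^{m·κ(ε₄+a)} − 1)`.  The dictionary is quantified over the solution family the scheme
produces (∀ X with the listed properties), so the instantiator states it for Bałaban's minimiser once. [folklore] -/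
theorem classifierWitness_of_prop6Scheme (h𝒢 : ∀ f, ‖𝒢 f‖ ≤ B₀ * ‖f‖) (hΛ : ∀ Y, ‖Λ Y‖ ≤ θ * ‖Y‖)
    (hW : Prop4Hyp W C₄ a₃) (hB₀ : 0 ≤ B₀) (hC₄ : 0 ≤ C₄) (hθ : 0 ≤ θ) {j a ε₄ : ℝ} (hε₄ : 0 ≤ ε₄)
    (hdom : 2 * (ε₄ + a) ≤ a₃) (hself : B₀ * j + θ * (ε₄ + a) + B₀ * C₄ * (ε₄ + a) ^ 2 ≤ ε₄)
    (hcontr : θ + 4 * B₀ * C₄ * (ε₄ + a) < 1) {Rad : ℝ} (hRad : 0 < Rad) {Jf : ℂ → 𝒵} {𝔄f : ℂ → 𝒴}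
    (hJd : DifferentiableOn ℂ Jf (ball 0 Rad)) (h𝔄d : DifferentiableOn ℂ 𝔄f (ball 0 Rad))
    (hJ : ∀ σ ∈ ball (0 : ℂ) Rad, ‖Jf σ‖ ≤ j) (h𝔄 : ∀ σ ∈ ball (0 : ℂ) Rad, ‖𝔄f σ‖ < a)
    (hJ0 : Jf 0 = 0) (h𝔄0 : 𝔄f 0 = 0)
    (ℓs : List (𝒴 →L[ℂ] A)) {κ : ℝ} (hκ : 0 ≤ κ) (hℓ : ∀ ℓ ∈ ℓs, ∀ Y, ‖ℓ Y‖ ≤ κ * ‖Y‖) {hol : ℝ → A}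
    (hhol : ∀ X : ℂ → 𝒴, (∀ σ ∈ ball (0 : ℂ) Rad, ‖X σ‖ ≤ ε₄ ∧ mapT 𝒢 Λ W (Jf σ) (𝔄f σ) (X σ) = X σ) →
      ∀ c : ℝ, 0 ≤ c → c ≤ 1 → hol c = wordExp (ℓs.map fun ℓ => ℓ (X (c : ℂ) + 𝔄f (c : ℂ)))) :
    ∃ f : ℂ → A, DifferentiableOn ℂ f (ball 0 Rad) ∧
      (∀ w ∈ ball (0 : ℂ) Rad, ‖f w‖ ≤ Real.exp (ℓs.length * (κ * (ε₄ + a))) - 1) ∧ f 0 = 0 ∧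
      ∀ c : ℝ, 0 ≤ c → c ≤ 1 → f (c : ℂ) = hol c - 1 := by
  obtain ⟨X, hXd, hX, hX0⟩ := solutionFamily_of_prop6Scheme h𝒢 hΛ hW hB₀ hC₄ hθ hε₄ hdom hself hcontr hRad hJd
    h𝔄d hJ h𝔄 hJ0 h𝔄0
  exact classifierWitness_of_solution hXd h𝔄d (fun σ hσ => (hX σ hσ).1) h𝔄 hX0 h𝔄0 ℓs hκ hℓ
    (hhol X fun σ hσ => ⟨(hX σ hσ).1, (hX σ hσ).2.1⟩)

end Composite

/-! ## §5 (v1.1) The Landau exponent `Ψ = id − H∘D` threaded through the read-outs -/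

section Landau

variable {A : Type*} [NormedRing A] [NormedAlgebra ℂ A] [CompleteSpace A]

omit [CompleteSpace 𝒴] [CompleteSpace A] in
/-- **A BOND READ-OUT OF THE LANDAU EXPONENT OF THE SOLUTION FAMILY** `σ ↦ ℓ (Ψ (X σ + 𝔄f σ))`: with `Ψ`
holomorphic on the ball `‖Y‖ < r₀` (`ε₄ + a ≤ r₀`), `Ψ 0 = 0`, `‖Ψ Y‖ ≤ ψ̄` there — the binder (Ψ-an) of
[Balaban1985Variational] (47)/(55)/(57) + Prop. 3 TYPE, NOT instantiated — the read-out is holomorphic on the disc,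
bounded by `κψ̄`, and vanishes at `0`. [folklore] -/
theorem bondFn_of_solution_landau {Rad ε₄ a κ r₀ ψbar : ℝ} {X 𝔄f : ℂ → 𝒴}
    (hXd : DifferentiableOn ℂ X (ball 0 Rad)) (h𝔄d : DifferentiableOn ℂ 𝔄f (ball 0 Rad))
    (hX : ∀ σ ∈ ball (0 : ℂ) Rad, ‖X σ‖ ≤ ε₄) (h𝔄 : ∀ σ ∈ ball (0 : ℂ) Rad, ‖𝔄f σ‖ < a) (hX0 : X 0 = 0)
    (h𝔄0 : 𝔄f 0 = 0) {Ψ : 𝒴 → 𝒴} (hr₀ : ε₄ + a ≤ r₀) (hΨd : DifferentiableOn ℂ Ψ (ball 0 r₀)) (hΨ0 : Ψ 0 = 0)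
    (hΨb : ∀ Y ∈ ball (0 : 𝒴) r₀, ‖Ψ Y‖ ≤ ψbar) (ℓ : 𝒴 →L[ℂ] A) (hκ : 0 ≤ κ) (hℓ : ∀ Y, ‖ℓ Y‖ ≤ κ * ‖Y‖) :
    DifferentiableOn ℂ (fun σ => ℓ (Ψ (X σ + 𝔄f σ))) (ball 0 Rad) ∧
      (∀ w ∈ ball (0 : ℂ) Rad, ‖ℓ (Ψ (X w + 𝔄f w))‖ ≤ κ * ψbar) ∧ ℓ (Ψ (X 0 + 𝔄f 0)) = 0 := by
  have hin : MapsTo (fun σ => X σ + 𝔄f σ) (ball (0 : ℂ) Rad) (ball (0 : 𝒴) r₀) := fun σ hσ => by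
    rw [mem_ball_zero_iff]
    exact ((norm_add_le _ _).trans_lt (add_lt_add_of_le_of_lt (hX σ hσ) (h𝔄 σ hσ))).trans_le hr₀
  refine ⟨ℓ.differentiable.comp_differentiableOn (hΨd.comp (hXd.add h𝔄d) hin), fun w hw => ?_,
    by rw [hX0, h𝔄0, add_zero, hΨ0, map_zero]⟩
  calc ‖ℓ (Ψ (X w + 𝔄f w))‖ ≤ κ * ‖Ψ (X w + 𝔄f w)‖ := hℓ _
    _ ≤ κ * ψbar := mul_le_mul_of_nonneg_left (hΨb _ (hin hw)) hκ

omit [CompleteSpace 𝒴] in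
/-- **THE (AN-bound) WITNESS OF A PLAQUETTE FROM THE SOLUTION FAMILY, LANDAU EXPONENT THREADED**: as
`classifierWitness_of_solution`, with the HOLONOMY DICTIONARY for the printed exponent — at a real parameter `c ∈ [0,1]`
the plaquette holonomy is the word of exponentials of the read-outs of `Ψ(X c + 𝔄f c)` ((112)/(174)/(176)); bound
`H = e^{m·κψ̄} − 1`. [folklore] -/
theorem classifierWitness_of_solution_landau {Rad ε₄ a κ r₀ ψbar : ℝ} {X 𝔄f : ℂ → 𝒴}
    (hXd : DifferentiableOn ℂ X (ball 0 Rad)) (h𝔄d : DifferentiableOn ℂ 𝔄f (ball 0 Rad))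
    (hX : ∀ σ ∈ ball (0 : ℂ) Rad, ‖X σ‖ ≤ ε₄) (h𝔄 : ∀ σ ∈ ball (0 : ℂ) Rad, ‖𝔄f σ‖ < a) (hX0 : X 0 = 0)
    (h𝔄0 : 𝔄f 0 = 0) {Ψ : 𝒴 → 𝒴} (hr₀ : ε₄ + a ≤ r₀) (hΨd : DifferentiableOn ℂ Ψ (ball 0 r₀)) (hΨ0 : Ψ 0 = 0)
    (hΨb : ∀ Y ∈ ball (0 : 𝒴) r₀, ‖Ψ Y‖ ≤ ψbar) (ℓs : List (𝒴 →L[ℂ] A)) (hκ : 0 ≤ κ)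
    (hℓ : ∀ ℓ ∈ ℓs, ∀ Y, ‖ℓ Y‖ ≤ κ * ‖Y‖) {hol : ℝ → A}
    (hhol : ∀ c : ℝ, 0 ≤ c → c ≤ 1 →
      hol c = wordExp (ℓs.map fun ℓ => ℓ (Ψ (X (c : ℂ) + 𝔄f (c : ℂ))))) :
    ∃ f : ℂ → A, DifferentiableOn ℂ f (ball 0 Rad) ∧
      (∀ w ∈ ball (0 : ℂ) Rad, ‖f w‖ ≤ Real.exp (ℓs.length * (κ * ψbar)) - 1) ∧ f 0 = 0 ∧
      ∀ c : ℝ, 0 ≤ c → c ≤ 1 → f (c : ℂ) = hol c - 1 := by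
  have hd : ∀ Xb ∈ ℓs.map (fun ℓ => fun σ => ℓ (Ψ (X σ + 𝔄f σ))), DifferentiableOn ℂ Xb (ball 0 Rad) := by
    intro Xb hXb
    obtain ⟨ℓ, hℓm, rfl⟩ := List.mem_map.1 hXb
    exact (bondFn_of_solution_landau hXd h𝔄d hX h𝔄 hX0 h𝔄0 hr₀ hΨd hΨ0 hΨb ℓ hκ (hℓ ℓ hℓm)).1
  have hb : ∀ Xb ∈ ℓs.map (fun ℓ => fun σ => ℓ (Ψ (X σ + 𝔄f σ))), ∀ w ∈ ball (0 : ℂ) Rad, ‖Xb w‖ ≤ κ * ψbar := by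
    intro Xb hXb
    obtain ⟨ℓ, hℓm, rfl⟩ := List.mem_map.1 hXb
    exact (bondFn_of_solution_landau hXd h𝔄d hX h𝔄 hX0 h𝔄0 hr₀ hΨd hΨ0 hΨb ℓ hκ (hℓ ℓ hℓm)).2.1
  have h0 : ∀ Xb ∈ ℓs.map (fun ℓ => fun σ => ℓ (Ψ (X σ + 𝔄f σ))), Xb 0 = 0 := by
    intro Xb hXb
    obtain ⟨ℓ, hℓm, rfl⟩ := List.mem_map.1 hXb
    exact (bondFn_of_solution_landau hXd h𝔄d hX h𝔄 hX0 h𝔄0 hr₀ hΨd hΨ0 hΨb ℓ hκ (hℓ ℓ hℓm)).2.2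
  have h := classifierWitness_of_bondData (Xs := ℓs.map (fun ℓ => fun σ => ℓ (Ψ (X σ + 𝔄f σ)))) hd hb h0
    (hol := hol) (fun c hc0 hc1 => by rw [hhol c hc0 hc1, List.map_map]; rfl)
  rwa [List.length_map] at h

/-- **SM-L1 FROM B11 PROP. 6's SCHEME WITH THE LANDAU EXPONENT, ONE CALL** (v1.1 form of
`classifierWitness_of_prop6Scheme`): (P2) + (P4) + (118)/(121) + holomorphic ray data with bounds and a flat centre +
(Ψ-an) + bond read-outs + the holonomy dictionary for `Ψ(X_σ + 𝔄_σ)` ⟹ the `hAN` witness with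
`(Rad, H = e^{m·κψ̄} − 1)`. [folklore] -/
theorem classifierWitness_of_prop6Scheme_landau (h𝒢 : ∀ f, ‖𝒢 f‖ ≤ B₀ * ‖f‖) (hΛ : ∀ Y, ‖Λ Y‖ ≤ θ * ‖Y‖)
    (hW : Prop4Hyp W C₄ a₃) (hB₀ : 0 ≤ B₀) (hC₄ : 0 ≤ C₄) (hθ : 0 ≤ θ) {j a ε₄ : ℝ} (hε₄ : 0 ≤ ε₄)
    (hdom : 2 * (ε₄ + a) ≤ a₃) (hself : B₀ * j + θ * (ε₄ + a) + B₀ * C₄ * (ε₄ + a) ^ 2 ≤ ε₄)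
    (hcontr : θ + 4 * B₀ * C₄ * (ε₄ + a) < 1) {Rad : ℝ} (hRad : 0 < Rad) {Jf : ℂ → 𝒵} {𝔄f : ℂ → 𝒴}
    (hJd : DifferentiableOn ℂ Jf (ball 0 Rad)) (h𝔄d : DifferentiableOn ℂ 𝔄f (ball 0 Rad))
    (hJ : ∀ σ ∈ ball (0 : ℂ) Rad, ‖Jf σ‖ ≤ j) (h𝔄 : ∀ σ ∈ ball (0 : ℂ) Rad, ‖𝔄f σ‖ < a)
    (hJ0 : Jf 0 = 0) (h𝔄0 : 𝔄f 0 = 0)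
    {Ψ : 𝒴 → 𝒴} {r₀ ψbar : ℝ} (hr₀ : ε₄ + a ≤ r₀) (hΨd : DifferentiableOn ℂ Ψ (ball 0 r₀)) (hΨ0 : Ψ 0 = 0)
    (hΨb : ∀ Y ∈ ball (0 : 𝒴) r₀, ‖Ψ Y‖ ≤ ψbar)
    (ℓs : List (𝒴 →L[ℂ] A)) {κ : ℝ} (hκ : 0 ≤ κ) (hℓ : ∀ ℓ ∈ ℓs, ∀ Y, ‖ℓ Y‖ ≤ κ * ‖Y‖) {hol : ℝ → A}
    (hhol : ∀ X : ℂ → 𝒴, (∀ σ ∈ ball (0 : ℂ) Rad, ‖X σ‖ ≤ ε₄ ∧ mapT 𝒢 Λ W (Jf σ) (𝔄f σ) (X σ) = X σ) →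
      ∀ c : ℝ, 0 ≤ c → c ≤ 1 → hol c = wordExp (ℓs.map fun ℓ => ℓ (Ψ (X (c : ℂ) + 𝔄f (c : ℂ))))) :
    ∃ f : ℂ → A, DifferentiableOn ℂ f (ball 0 Rad) ∧
      (∀ w ∈ ball (0 : ℂ) Rad, ‖f w‖ ≤ Real.exp (ℓs.length * (κ * ψbar)) - 1) ∧ f 0 = 0 ∧
      ∀ c : ℝ, 0 ≤ c → c ≤ 1 → f (c : ℂ) = hol c - 1 := by
  obtain ⟨X, hXd, hX, hX0⟩ := solutionFamily_of_prop6Scheme h𝒢 hΛ hW hB₀ hC₄ hθ hε₄ hdom hself hcontr hRad hJd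
    h𝔄d hJ h𝔄 hJ0 h𝔄0
  exact classifierWitness_of_solution_landau hXd h𝔄d (fun σ hσ => (hX σ hσ).1) h𝔄 hX0 h𝔄0 hr₀ hΨd hΨ0 hΨb ℓs hκ
    hℓ (hhol X fun σ hσ => ⟨(hX σ hσ).1, (hX σ hσ).2.1⟩)

end Landau

end Summit.QuantumFields.BalabanUV.T4Continuum.ShellMeasureMinimiserBonds
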